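import Mathlib
import Summits.Ventures.PercRepro2.Defs
import Summits.Ventures.PercRepro2.Independence
import Summits.Ventures.PercRepro2.Harris
import Summits.Ventures.PercRepro2.Graph
import Summits.Ventures.PercRepro2.Exploration
import Summits.Ventures.PercRepro2.Events
import Summits.Ventures.PercRepro2.Induced
import Summits.Ventures.PercRepro2.SeedSet
import Summits.Ventures.PercRepro2.YBridge
import Summits.Ventures.PercRepro2.ExplorationTree
import Summits.Ventures.PercRepro2.ZhTwoCopy
import Summits.Ventures.PercRepro2.ExplorationT
import Summits.Ventures.PercRepro2.ExplorationSL1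

/-!
# The canonical exploration from `a₃` is a T-exploration (blind cell PercRepro2, typer-1; p1 g5
`proofs/P1-L1TWOCOPY.md` §6)

The rule: reveal the first unexplored edge (in a fixed enumeration `es` of the edges) touching the
explored cluster of `a₃` (the component of `a₃` in the explored open edges, `exploredCluster`);
STOP when `a₂` joins it, FAIL when `a₁` joins it, stop when no unexplored edge touches it.
`exploreTree` builds the decision tree by recursion on the number of unexplored edges.

* `valid_exploreTree`: every edge is revealed at most once along each branch;
* `stop_of_mem_leaves`: every leaf satisfies the stopping rule (`Stop`);
* `exploredCluster_subset_cluster`: on the leaf's event the explored cluster lies in `C(a₃)`;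
  `cluster_subset_exploredCluster_of_none`: at an exhausted leaf `C(a₃)` is the explored cluster;
* **`canonical`**: the `TExploration ends a₁ a₂ a₃` with T-leaves `{a₂ ∈ X, a₁ ∉ X}` and seed sets
  `X = exploredCluster` — so `ZhTwoCopy_of_SL1` applies to it (`ZhTwoCopy_of_SL1_canonical`): the
  (C1) row follows from `0 ≤ SL1 p o b (canonical …)`, p1's sub-lemma for THIS exploration rule.
-/

namespace Summit.Ventures.PercRepro2

namespace ExplorationTree

namespace Canonical

open Classical

section Defs

variable {V : Type*} {E : Type*} [Fintype V] [Fintype E] [DecidableEq E]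

/-- The explored configuration: `σ` on `F`, closed elsewhere. -/
def explored (F : Finset E) (σ : Config E) : Config E := fun e => if e ∈ F then σ e else false

/-- The explored cluster of `a₃`: the component of `a₃` in the explored open edges. -/
noncomputable def exploredCluster (ends : E → Sym2 V) (a₃ : V) (F : Finset E) (σ : Config E) :
    Finset V :=
  Finset.univ.filter fun v => Conn ends (explored F σ) a₃ v

/-- The next edge to reveal: the first unexplored edge of `es` touching the explored cluster. -/
noncomputable def nextEdge (ends : E → Sym2 V) (a₃ : V) (es : List E) (F : Finset E)
    (σ : Config E) : Option E :=
  es.find? fun e => decide (e ∉ F ∧ e ∈ touches ends (↑(exploredCluster ends a₃ F σ) : Set V))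

/-- The stopping rule: `a₂` or `a₁` has joined the explored cluster, or the frontier is exhausted. -/
def Stop (ends : E → Sym2 V) (a₁ a₂ a₃ : V) (es : List E) (F : Finset E) (σ : Config E) : Prop :=
  a₂ ∈ exploredCluster ends a₃ F σ ∨ a₁ ∈ exploredCluster ends a₃ F σ ∨
    nextEdge ends a₃ es F σ = none

/-- The found edge is unexplored. -/
lemma nextEdge_notMem {ends : E → Sym2 V} {a₃ : V} {es : List E} {F : Finset E} {σ : Config E}
    {e : E} (h : nextEdge ends a₃ es F σ = some e) : e ∉ F := by
  unfold nextEdge at h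
  have hp := List.find?_some h
  simp only [decide_eq_true_eq] at hp
  exact hp.1

/-- The canonical exploration tree from `a₃`, started at the explored set `F` with states `σ`. -/
noncomputable def exploreTree (ends : E → Sym2 V) (a₁ a₂ a₃ : V) (es : List E) (F : Finset E)
    (σ : Config E) : ETree E :=
  if a₂ ∈ exploredCluster ends a₃ F σ ∨ a₁ ∈ exploredCluster ends a₃ F σ then .leaf
  else
    match _hne : nextEdge ends a₃ es F σ with
    | none => .leaf
    | some e =>
      .node e (exploreTree ends a₁ a₂ a₃ es (insert e F) (Function.update σ e false))
        (exploreTree ends a₁ a₂ a₃ es (insert e F) (Function.update σ e true))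
termination_by (Finset.univ \ F).card
decreasing_by
  all_goals
    have he : e ∉ F := nextEdge_notMem _hne
    rw [Finset.sdiff_insert]
    exact Finset.card_erase_lt_of_mem (Finset.mem_sdiff.2 ⟨Finset.mem_univ e, he⟩)

end Defs

section Lemmas

variable {V : Type*} {E : Type*} [Fintype V] [Fintype E] [DecidableEq E]

/-- Membership in the explored cluster. -/
lemma mem_exploredCluster {ends : E → Sym2 V} {a₃ : V} {F : Finset E} {σ : Config E} {v : V} :
    v ∈ exploredCluster ends a₃ F σ ↔ Conn ends (explored F σ) a₃ v := by
  simp [exploredCluster]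

omit [Fintype E] in
/-- The explored configuration lies below every configuration of the cylinder. -/
lemma explored_le_of_mem_cylinder {F : Finset E} {σ ω : Config E} (hω : ω ∈ cylinder F σ) :
    explored F σ ≤ ω := by
  intro e
  unfold explored
  by_cases he : e ∈ F
  · rw [if_pos he, hω e he]
  · rw [if_neg he]
    exact Bool.false_le _

/-- On the cylinder, the explored cluster lies in `C(a₃)`. -/
lemma exploredCluster_subset_cluster {ends : E → Sym2 V} {a₃ : V} {F : Finset E} {σ ω : Config E}
    (hω : ω ∈ cylinder F σ) {v : V} (hv : v ∈ exploredCluster ends a₃ F σ) :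
    Conn ends ω a₃ v :=
  conn_mono (explored_le_of_mem_cylinder hω) (mem_exploredCluster.1 hv)

/-- At an exhausted frontier every edge touching the explored cluster is explored. -/
lemma mem_of_nextEdge_none {ends : E → Sym2 V} {a₃ : V} {es : List E} (hes : ∀ e, e ∈ es)
    {F : Finset E} {σ : Config E} (h : nextEdge ends a₃ es F σ = none) {e : E}
    (he : e ∈ touches ends (↑(exploredCluster ends a₃ F σ) : Set V)) : e ∈ F := by
  unfold nextEdge at h
  have h' := List.find?_eq_none.1 h e (hes e)
  simp only [decide_eq_true_eq] at h'
  by_contra hF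
  exact h' ⟨hF, he⟩

/-- At an exhausted frontier, on the cylinder, `C(a₃)` is the explored cluster. -/
lemma cluster_subset_exploredCluster_of_none {ends : E → Sym2 V} {a₃ : V} {es : List E}
    (hes : ∀ e, e ∈ es) {F : Finset E} {σ ω : Config E} (hω : ω ∈ cylinder F σ)
    (h : nextEdge ends a₃ es F σ = none) {v : V} (hv : Conn ends ω a₃ v) :
    v ∈ exploredCluster ends a₃ F σ := by
  refine mem_of_conn_of_closed (S := {v | v ∈ exploredCluster ends a₃ F σ}) ?_
    (mem_exploredCluster.2 (conn_refl ends _ a₃)) hv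
  intro x hx y hxy
  rw [openGraph_adj] at hxy
  obtain ⟨_, e, he, hends⟩ := hxy
  have hx' : x ∈ exploredCluster ends a₃ F σ := hx
  have ht : e ∈ touches ends (↑(exploredCluster ends a₃ F σ) : Set V) :=
    mem_touches_of_ends hends (Or.inl (Finset.mem_coe.2 hx'))
  have heF : e ∈ F := mem_of_nextEdge_none hes h ht
  have hopen : explored F σ e = true := by
    unfold explored
    rw [if_pos heF, ← hω e heF, he]
  show y ∈ exploredCluster ends a₃ F σ
  rw [mem_exploredCluster]
  exact conn_trans (mem_exploredCluster.1 hx') (conn_of_openAdj ⟨e, hopen, hends⟩)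

/-- The tree is valid from its starting explored set. -/
theorem valid_exploreTree (ends : E → Sym2 V) (a₁ a₂ a₃ : V) (es : List E) :
    ∀ n, ∀ (F : Finset E) (σ : Config E), (Finset.univ \ F).card = n →
      Valid (exploreTree ends a₁ a₂ a₃ es F σ) F := by
  intro n
  induction n using Nat.strong_induction_on with
  | _ n ih =>
  intro F σ hn
  rw [exploreTree]
  split_ifs with hstop
  · trivial
  · split
    · trivial
    · rename_i e he
      have hnot : e ∉ F := nextEdge_notMem he
      have hcard : (Finset.univ \ insert e F).card < n := by
        rw [← hn, Finset.sdiff_insert]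
        exact Finset.card_erase_lt_of_mem (Finset.mem_sdiff.2 ⟨Finset.mem_univ e, hnot⟩)
      exact ⟨hnot, ih _ hcard _ _ rfl, ih _ hcard _ _ rfl⟩

/-- Every leaf of the tree satisfies the stopping rule. -/
theorem stop_of_mem_leaves (ends : E → Sym2 V) (a₁ a₂ a₃ : V) (es : List E) :
    ∀ n, ∀ (F : Finset E) (σ : Config E), (Finset.univ \ F).card = n →
      ∀ ℓ ∈ leaves (exploreTree ends a₁ a₂ a₃ es F σ) ⟨F, σ⟩, Stop ends a₁ a₂ a₃ es ℓ.F ℓ.σ := by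
  intro n
  induction n using Nat.strong_induction_on with
  | _ n ih =>
  intro F σ hn ℓ hℓ
  rw [exploreTree] at hℓ
  split_ifs at hℓ with hstop
  · simp only [leaves, List.mem_singleton] at hℓ
    subst hℓ
    rcases hstop with h | h
    · exact Or.inl h
    · exact Or.inr (Or.inl h)
  · split at hℓ
    · rename_i hnone
      simp only [leaves, List.mem_singleton] at hℓ
      subst hℓ
      exact Or.inr (Or.inr hnone)
    · rename_i e he
      have hnot : e ∉ F := nextEdge_notMem he
      have hcard : (Finset.univ \ insert e F).card < n := by
        rw [← hn, Finset.sdiff_insert]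
        exact Finset.card_erase_lt_of_mem (Finset.mem_sdiff.2 ⟨Finset.mem_univ e, hnot⟩)
      simp only [leaves, List.mem_append] at hℓ
      rcases hℓ with hℓ | hℓ
      · exact ih _ hcard _ _ rfl ℓ hℓ
      · exact ih _ hcard _ _ rfl ℓ hℓ

end Lemmas

/-! ## The canonical T-exploration -/

section Canonical

variable {V : Type*} {E : Type*} [Fintype V] [DecidableEq V] [Fintype E] [DecidableEq E]

/-- **The canonical exploration from `a₃` is a T-exploration**: T-leaves `{a₂ ∈ X, a₁ ∉ X}`, seed
sets `X = exploredCluster`. -/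
noncomputable def canonical (ends : E → Sym2 V) (a₁ a₂ a₃ : V) (es : List E) (hes : ∀ e, e ∈ es) :
    TExploration ends a₁ a₂ a₃ where
  tree := exploreTree ends a₁ a₂ a₃ es ∅ (fun _ => false)
  valid := valid_exploreTree ends a₁ a₂ a₃ es _ ∅ _ rfl
  isT := fun ℓ => decide (a₂ ∈ exploredCluster ends a₃ ℓ.F ℓ.σ ∧ a₁ ∉ exploredCluster ends a₃ ℓ.F ℓ.σ)
  seed := fun ℓ => exploredCluster ends a₃ ℓ.F ℓ.σ
  T_inter := by
    intro ℓ _ hT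
    have hT' : a₂ ∈ exploredCluster ends a₃ ℓ.F ℓ.σ ∧ a₁ ∉ exploredCluster ends a₃ ℓ.F ℓ.σ := by
      simpa using hT
    ext ω
    simp only [Set.mem_inter_iff, TEvent, Set.mem_compl_iff, mem_connEvent, mem_avoidAll,
      Finset.mem_singleton, forall_eq]
    constructor
    · rintro ⟨hω, h21, _⟩
      exact ⟨hω, h21⟩
    · rintro ⟨hω, h21⟩
      refine ⟨hω, h21, ?_⟩
      exact conn_symm (exploredCluster_subset_cluster hω hT'.1)
  nonT := by
    intro ℓ hℓ hT
    have hstop := stop_of_mem_leaves ends a₁ a₂ a₃ es _ ∅ (fun _ => false) rfl ℓ hℓ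
    have hT' : ¬ (a₂ ∈ exploredCluster ends a₃ ℓ.F ℓ.σ ∧ a₁ ∉ exploredCluster ends a₃ ℓ.F ℓ.σ) := by
      simpa using hT
    ext ω
    simp only [Set.mem_inter_iff, TEvent, Set.mem_compl_iff, mem_connEvent, Set.mem_empty_iff_false,
      iff_false, not_and]
    intro hω h21 h23
    by_cases h1 : a₁ ∈ exploredCluster ends a₃ ℓ.F ℓ.σ
    · -- `a₁` joined: `a₁ ∈ C(a₃) ⊆ C(a₂)`
      exact h21 (conn_trans h23 (exploredCluster_subset_cluster hω h1))
    · have h2 : a₂ ∉ exploredCluster ends a₃ ℓ.F ℓ.σ := fun h2 => hT' ⟨h2, h1⟩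
      rcases hstop with h | h | hnone
      · exact h2 h
      · exact h1 h
      · exact h2 (cluster_subset_exploredCluster_of_none hes hω hnone (conn_symm h23))
  determined := by
    intro ℓ _ hT ω hω
    have hT' : a₂ ∈ exploredCluster ends a₃ ℓ.F ℓ.σ ∧ a₁ ∉ exploredCluster ends a₃ ℓ.F ℓ.σ := by
      simpa using hT
    have h32 : Conn ends ω a₃ a₂ := exploredCluster_subset_cluster hω hT'.1
    ext x
    simp only [mem_cluster, mem_clusterSet]
    constructor
    · intro hx
      exact ⟨a₂, hT'.1, hx⟩
    · rintro ⟨s, hs, hsx⟩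
      have h3s : Conn ends ω a₃ s := exploredCluster_subset_cluster hω hs
      exact conn_trans (conn_trans (conn_symm h32) h3s) hsx

end Canonical

section Corollary

variable {V : Type*} {E : Type*} [Fintype V] [DecidableEq V] [Fintype E] [DecidableEq E]
  {R : Type*} [Field R] [LinearOrder R] [IsStrictOrderedRing R]

/-- **(C1) from p1's sub-lemma for the canonical exploration**: `0 ≤ SL1 (canonical …)` gives
`ZhTwoCopy`. -/
theorem ZhTwoCopy_of_SL1_canonical (p : E → R) (hp : IsProbVec p) (ends : E → Sym2 V)
    (o a₁ a₂ a₃ b : V) (es : List E) (hes : ∀ e, e ∈ es)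
    (h : 0 ≤ SL1 p o b (canonical ends a₁ a₂ a₃ es hes)) : ZhTwoCopy p ends o a₁ a₂ a₃ b :=
  ZhTwoCopy_of_SL1 p hp ends o a₁ a₂ a₃ b _ h

end Corollary

end Canonical

end ExplorationTree

end Summit.Ventures.PercRepro2
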